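import Literature.Computability.QuantumComplexity.FactoringNP
import Literature.Computability.Complexity.BinarySearchPP
import Literature.Computability.Complexity.HashBricks
import Literature.Computability.Complexity.IterateFP
import Literature.Computability.Complexity.StackBricksArith
import Literature.Computability.Complexity.LengthCompare
import Literature.Computability.Complexity.ListFoldChecks
import HarnessLib

/-!
# The Liouville function with a factoring oracle, I: the peeling machine

Topic `Computability/QuantumComplexity`, companion of `Factoring.lean` (`FACT`, the bounded-divisor
language) and `BinarySearchPP.lean` (bit-by-bit binary search with an oracle, Arora–Barak 2009
§17.2.1). Folklore: **`Ω(N)`, hence `λ(N)`, is computable in polynomial time with an oracle for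
`FACT = {⟨M, k⟩ : ∃ d, 1 < d ≤ k, d ∣ M}`** — search-to-decision for factoring (Arora–Barak 2009,
Example 2.3, §2.7): the least prime factor of `M` is found by binary search on
`k ↦ [⟨M, k⟩ ∈ FACT] = [minFac M ≤ k]`, then one divides and repeats.

This file is the MACHINE half, in the `FP` brick algebra (no new Turing machine): the adaptive
reduction of `AdaptiveQueries.lean` wants a query generator `Q ∈ FP` on `⟨x, answers so far⟩` and
an evaluator in `P`; both REPLAY the answer bits through the **peeling loop** with state
`⟨rest, ⟨M, ⟨pre, cnt⟩⟩⟩` (`M` the cofactor still to factor, a numeral; `pre` the most significant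
digits of `minFac M` learnt so far, width `D = |x| + 1`; `cnt` the number of primes peeled off): a
round consumes a bit `b` and appends the digit `¬b`; on `D` digits, `M := M / value`, `cnt := cnt+1`,
`pre := ε`; once `M < 2` bits are ignored.

* `LiouvilleOracle.replay D st bits` — the mathematical model (left fold of `peelStep D`);
* `LiouvilleOracle.peelRound` — one round on `⟨⟨x, a⟩, state⟩` (header preserved, supplying `D`):
  `peelRound_cons` / `peelRound_nil`, `length_peelRound_le` (additive growth `9`),
  `peelRound_mem_FP`, `iterate_peelRound` (the clocked loop realises `replay`);
* `LiouvilleOracle.peelRunFn` — `⟨x, a⟩ ↦` the record after replaying `a` from `⟨⟦x⟧, ε, 0⟩`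
  (`peelRunFn_boolPair`, `peelRunFn_mem_FP`);
* `LiouvilleOracle.peelQryFn` — the query `⟨⌜M⌝, ⌜θ⌝⟩`, `θ = val(1^{D−1−|pre|} 0 preᴿ)`
  (`BinarySearchPP.qryNum`; `peelQryFn_boolPair`, `peelQryFn_mem_FP`);
* `LiouvilleOracle.peelEvalFn par` — the bit `[x = ⌜N⌝ ∧ N ≠ 0 ∧ (Odd cnt ↔ par)]` (`peelEvalFn_boolPair`,
  `peelEvalFn_mem_FP`, `oneBit_peelEvalFn`).

The oracle analysis and `L_λ ∈ P^{FACT}`, `FACT ∈ P/poly → L_λ ∈ P/poly`, `FACT ∈ P → L_λ ∈ P`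
are in `LiouvilleFactoringOracle.lean`.

References: S. Arora, B. Barak, *Computational Complexity: A Modern Approach*, CUP 2009, Example 2.3,
§2.7, §3.4, §17.2.1; L. M. Adleman, K. S. McCurley, *Open problems in number theoretic complexity,
II*, LNCS 877 (1994). -/

namespace Literature.Computability.QuantumComplexity

open _root_.Computability Polynomial Complexity Complexity.Brick Complexity.BinSearchPP
open Complexity.Plumb Complexity.OracleCompose Complexity.PRelSigma Complexity.TTClosure

namespace LiouvilleOracle

/-! ### The mathematical model of the peeling loop -/

/-- The loop state (mathematical): cofactor `M`, digit prefix `pre`, count `cnt`. [folklore] -/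
abbrev PState : Type := ℕ × List Bool × ℕ

/-- **One step of the peeling loop** on an answer bit `b` (width `D`): ignore if `M < 2`; else
append the digit `¬b`; on a full block divide `M` by the value of the (most-significant-first)
digits, reset the prefix and count one prime factor. [cite: AroraBarak2009, §2.7] -/
def peelStep (D : ℕ) (st : PState) (b : Bool) : PState :=
  if 2 ≤ st.1 then
    if D ≤ (st.2.1 ++ [!b]).length then (st.1 / bitsToNat (st.2.1 ++ [!b]).reverse, [], st.2.2 + 1)
    else (st.1, st.2.1 ++ [!b], st.2.2)
  else st

/-- **The replay** of a list of answer bits: the left fold of `peelStep`. [folklore] -/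
def replay (D : ℕ) (st : PState) (bits : List Bool) : PState :=
  bits.foldl (peelStep D) st

/-- Replay of a snoc. [folklore] -/
theorem replay_append_singleton (D : ℕ) (st : PState) (bits : List Bool) (b : Bool) :
    replay D st (bits ++ [b]) = peelStep D (replay D st bits) b := by
  simp [replay, List.foldl_append]

/-- Replay of nothing. [folklore] -/
@[simp] theorem replay_nil (D : ℕ) (st : PState) : replay D st [] = st := rfl

/-- Once `M < 2` the replay is idle. [folklore] -/
theorem replay_of_lt_two (D : ℕ) {st : PState} (h : st.1 < 2) (bits : List Bool) : replay D st bits = st := by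
  induction bits with
  | nil => rfl
  | cons b bits ih =>
    have : peelStep D st b = st := by simp [peelStep, Nat.not_le.2 h]
    rw [replay, List.foldl_cons, this]; exact ih

/-- The coded state `⟨⌜M⌝, ⟨pre, ⌜cnt⌝⟩⟩`. [folklore] -/
def encSt (st : PState) : List Bool := boolPair (encodeNat st.1) (boolPair st.2.1 (encodeNat st.2.2))

/-! ### One round of the loop, as a string function

The loop record is `z = ⟨hdr, ⟨rest, ⟨M, ⟨pre, cnt⟩⟩⟩⟩` with `hdr = ⟨x, a⟩` preserved (it supplies
the width `D = |x| + 1` as the ruler `1ᴰ`). -/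

/-- Field `x` of the record (inside the preserved header). [folklore] -/
noncomputable def zX : List Bool → List Bool := fstF ∘ fstF
/-- Field `rest` (answer bits not yet consumed). [folklore] -/
noncomputable def zRest : List Bool → List Bool := nthF 1
/-- Field `M` (numeral of the cofactor). [folklore] -/
noncomputable def zM : List Bool → List Bool := nthF 2
/-- Field `pre` (digit prefix). [folklore] -/
noncomputable def zPre : List Bool → List Bool := nthF 3
/-- Field `cnt` (numeral of the count). [folklore] -/
noncomputable def zCnt : List Bool → List Bool := sndPow 3

/-- The extended prefix `pre ++ [¬ head rest]`. [folklore] -/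
noncomputable def pre1F : List Bool → List Bool :=
  concatFn ∘ fanoutFn zPre (notFn (HashBricks.headBitFn ∘ zRest))

/-- The test "the extended prefix is a full block": `[|x| + 1 ≤ |pre₁|]`. [folklore] -/
noncomputable def fullF : List Bool → List Bool := lenLeFn X ∘ fanoutFn pre1F (polyFn (X + 1) ∘ zX)

/-- The new state after consuming one bit (the three live branches). [folklore] -/
noncomputable def newStF : List Bool → List Bool :=
  iteFn (valGeTwoFn ∘ zM)
    (iteFn fullF
      (fanoutFn (List.tail ∘ zRest) (fanoutFn (divFn ∘ fanoutFn zM (norm ∘ List.reverse ∘ pre1F))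
        (fanoutFn (fun _ => []) (addFn ∘ fanoutFn zCnt (fun _ => encodeNat 1)))))
      (fanoutFn (List.tail ∘ zRest) (fanoutFn zM (fanoutFn pre1F zCnt))))
    (fanoutFn (List.tail ∘ zRest) (fanoutFn zM (fanoutFn zPre zCnt)))

/-- **One round of the peeling loop**: keep the header; if `rest = ε` keep the state, else
consume one bit. [cite: AroraBarak2009, §2.7] -/
noncomputable def peelRound : List Bool → List Bool :=
  fanoutFn fstF (iteFn (isNilFn ∘ zRest) sndF newStF)

/-- `pre1F ∈ FP`. [folklore] -/
theorem pre1F_mem_FP : pre1F ∈ FP :=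
  comp_mem_FP concatFn_mem_FP (fanoutFn_mem_FP (nthF_mem_FP 3)
    (notFn_mem_FP (comp_mem_FP HashBricks.headBitFn_mem_FP (nthF_mem_FP 1))))

/-- `fullF ∈ FP`. [folklore] -/
theorem fullF_mem_FP : fullF ∈ FP :=
  comp_mem_FP (lenLeFn_mem_FP X) (fanoutFn_mem_FP pre1F_mem_FP
    (comp_mem_FP (polyFn_mem_FP _) (comp_mem_FP fstF_mem_FP fstF_mem_FP)))

/-- `newStF ∈ FP`. [folklore] -/
theorem newStF_mem_FP : newStF ∈ FP := by
  have hR : (List.tail ∘ zRest) ∈ FP := comp_mem_FP tail_mem_FP (nthF_mem_FP 1)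
  have hM : zM ∈ FP := nthF_mem_FP 2
  have hP : zPre ∈ FP := nthF_mem_FP 3
  have hC : zCnt ∈ FP := sndPow_mem_FP 3
  refine iteFn_mem_FP (comp_mem_FP valGeTwoFn_mem_FP hM)
    (iteFn_mem_FP fullF_mem_FP
      (fanoutFn_mem_FP hR (fanoutFn_mem_FP
        (comp_mem_FP divFn_mem_FP (fanoutFn_mem_FP hM
          (comp_mem_FP norm_mem_FP (comp_mem_FP reverse_mem_FP pre1F_mem_FP))))
        (fanoutFn_mem_FP (const_mem_FP _) (comp_mem_FP addFn_mem_FP (fanoutFn_mem_FP hC (const_mem_FP _))))))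
      (fanoutFn_mem_FP hR (fanoutFn_mem_FP hM (fanoutFn_mem_FP pre1F_mem_FP hC))))
    (fanoutFn_mem_FP hR (fanoutFn_mem_FP hM (fanoutFn_mem_FP hP hC)))

/-- **`peelRound ∈ FP`.** [cite: AroraBarak2009, §1.3] -/
theorem peelRound_mem_FP : peelRound ∈ FP :=
  fanoutFn_mem_FP fstF_mem_FP (iteFn_mem_FP (comp_mem_FP isNilFn_mem_FP (nthF_mem_FP 1)) sndF_mem_FP newStF_mem_FP)

/-! ### Values of the round -/

section Values

variable (x a : List Bool)

/-- The record `⟨⟨x, a⟩, ⟨rest, encSt st⟩⟩`. [folklore] -/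
def rec (rest : List Bool) (st : PState) : List Bool :=
  boolPair (boolPair x a) (boolPair rest (encSt st))

variable {x a}

/-- Reading `x` off a record. [folklore] -/
@[simp] theorem zX_rec (rest : List Bool) (st : PState) : zX (rec x a rest st) = x := by simp [zX, rec]
/-- Reading `rest` off a record. [folklore] -/
@[simp] theorem zRest_rec (rest : List Bool) (st : PState) : zRest (rec x a rest st) = rest := by
  simp [zRest, rec, nthF]
/-- Reading `⌜M⌝` off a record. [folklore] -/
@[simp] theorem zM_rec (rest : List Bool) (st : PState) : zM (rec x a rest st) = encodeNat st.1 := by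
  simp [zM, rec, nthF, encSt]
/-- Reading `pre` off a record. [folklore] -/
@[simp] theorem zPre_rec (rest : List Bool) (st : PState) : zPre (rec x a rest st) = st.2.1 := by
  simp [zPre, rec, nthF, encSt]
/-- Reading `⌜cnt⌝` off a record. [folklore] -/
@[simp] theorem zCnt_rec (rest : List Bool) (st : PState) : zCnt (rec x a rest st) = encodeNat st.2.2 := by
  simp [zCnt, rec, sndPow, encSt]

/-- Value of the extended prefix on a record with `rest = b :: r`. [folklore] -/
theorem pre1F_rec (b : Bool) (r : List Bool) (st : PState) :
    pre1F (rec x a (b :: r) st) = st.2.1 ++ [!b] := by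
  have hb : (HashBricks.headBitFn ∘ zRest) (rec x a (b :: r) st) = [b] := by
    simp [Function.comp_apply]
  rw [pre1F, Function.comp_apply, fanoutFn_apply, notFn_apply hb, concatFn_boolPair, zPre_rec]

/-- Value of the full-block test. [folklore] -/
theorem fullF_rec (b : Bool) (r : List Bool) (st : PState) :
    fullF (rec x a (b :: r) st) = [decide (x.length + 1 ≤ (st.2.1 ++ [!b]).length)] := by
  rw [fullF, Function.comp_apply, fanoutFn_apply, pre1F_rec, Function.comp_apply, zX_rec, polyFn_apply,
    lenLeFn_boolPair]
  simp [ones]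

/-- **The round on a nonempty `rest` is `peelStep`.** [cite: AroraBarak2009, §2.7] -/
theorem peelRound_cons (b : Bool) (r : List Bool) (st : PState) :
    peelRound (rec x a (b :: r) st) = rec x a r (peelStep (x.length + 1) st b) := by
  have hnil : (isNilFn ∘ zRest) (rec x a (b :: r) st) = [false] := by
    simp [Function.comp_apply, isNilFn]
  rw [peelRound, fanoutFn_apply, iteFn_apply_false hnil]
  have hge : (valGeTwoFn ∘ zM) (rec x a (b :: r) st) = [decide (2 ≤ st.1)] := by
    simp [Function.comp_apply, valGeTwoFn]
  have hfst : fstF (rec x a (b :: r) st) = boolPair x a := by simp [rec]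
  rw [hfst, newStF, iteFn_apply hge]
  by_cases h2 : 2 ≤ st.1
  · rw [if_pos (by simpa using h2), iteFn_apply (fullF_rec b r st)]
    by_cases hD : x.length + 1 ≤ (st.2.1 ++ [!b]).length
    · rw [if_pos (by simpa using hD),
        show peelStep (x.length + 1) st b = (st.1 / bitsToNat (st.2.1 ++ [!b]).reverse, [], st.2.2 + 1) by
          simp only [peelStep, if_pos h2, if_pos hD]]
      simp only [fanoutFn_apply, Function.comp_apply, zRest_rec, zM_rec, zCnt_rec, pre1F_rec, List.tail_cons,
        divFn_boolPair, addFn_boolPair, bitsToNat_encodeNat, norm_eq_encodeNat]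
      simp [rec, encSt]
    · rw [if_neg (by simpa using hD),
        show peelStep (x.length + 1) st b = (st.1, st.2.1 ++ [!b], st.2.2) by
          simp only [peelStep, if_pos h2, if_neg hD]]
      simp only [fanoutFn_apply, Function.comp_apply, zRest_rec, zM_rec, zCnt_rec, pre1F_rec, List.tail_cons]
      simp [rec, encSt]
  · rw [if_neg (by simpa using h2), show peelStep (x.length + 1) st b = st by simp only [peelStep, if_neg h2]]
    simp only [fanoutFn_apply, Function.comp_apply, zRest_rec, zM_rec, zPre_rec, zCnt_rec, List.tail_cons]
    simp [rec, encSt]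

/-- The round on an empty `rest` is the identity. [folklore] -/
theorem peelRound_nil (st : PState) : peelRound (rec x a [] st) = rec x a [] st := by
  have hnil : (isNilFn ∘ zRest) (rec x a [] st) = [true] := by
    simp [Function.comp_apply, isNilFn]
  rw [peelRound, fanoutFn_apply, iteFn_apply_true hnil]
  simp [rec]

/-- **The clocked loop realises the replay**: `n` rounds consume `rest ↾ n`. [folklore] -/
theorem iterate_peelRound : ∀ (n : ℕ) (rest : List Bool) (st : PState),
    peelRound^[n] (rec x a rest st) = rec x a (rest.drop n) (replay (x.length + 1) st (rest.take n))
  | 0, rest, st => by simp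
  | n + 1, [], st => by
    rw [Function.iterate_succ_apply, peelRound_nil, iterate_peelRound n [] st]
    simp
  | n + 1, b :: r, st => by
    rw [Function.iterate_succ_apply, peelRound_cons, iterate_peelRound n r]
    rfl

end Values

/-! ### Growth of the round (on every string) -/

/-- `|pre1F w| ≤ |zPre w| + 1`. [folklore] -/
theorem length_pre1F_le (w : List Bool) : (pre1F w).length ≤ (zPre w).length + 1 := by
  obtain ⟨b, hb⟩ := (oneBit_notFn (HashBricks.oneBit_headBitFn.comp zRest)) w
  rw [pre1F, Function.comp_apply, fanoutFn_apply, concatFn_boolPair, List.length_append, hb]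
  simp

/-- **The round lengthens no string by more than `9`.** [folklore] -/
theorem length_peelRound_le (w : List Bool) : (peelRound w).length ≤ w.length + 9 := by
  have h0 := length_fstF_sndF_le w
  have h1 := length_fstF_sndF_le (sndF w)
  have h2 := length_fstF_sndF_le (sndF (sndF w))
  have h3 := length_fstF_sndF_le (sndF (sndF (sndF w)))
  have hR : (zRest w) = fstF (sndF w) := rfl
  have hM : (zM w) = fstF (sndF (sndF w)) := rfl
  have hP : (zPre w) = fstF (sndF (sndF (sndF w))) := rfl
  have hC : (zCnt w) = sndF (sndF (sndF (sndF w))) := rfl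
  rw [peelRound, fanoutFn_apply, length_boolPair]
  rcases (oneBit_isNilFn.comp zRest) w with ⟨b, hb⟩
  rw [iteFn_apply hb]
  cases b
  · simp only [Bool.false_eq_true, ↓reduceIte] -- `rest ≠ ε`: one bit is consumed
    have hrest : (zRest w) ≠ [] := by
      intro h
      have : (isNilFn ∘ zRest) w = [true] := by simp [Function.comp_apply, h, isNilFn]
      rw [this] at hb; simp at hb
    have htail : (zRest w).tail.length + 1 ≤ (zRest w).length := by
      cases hz : zRest w with
      | nil => exact absurd hz hrest
      | cons c l => simp
    have hp1 := length_pre1F_le w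
    have hdiv : (divFn (fanoutFn zM (norm ∘ List.reverse ∘ pre1F) w)).length ≤ (zM w).length := by
      rw [fanoutFn_apply, divFn_boolPair]
      calc (encodeNat (bitsToNat (zM w) / bitsToNat ((norm ∘ List.reverse ∘ pre1F) w))).length
          ≤ (encodeNat (bitsToNat (zM w))).length := length_encodeNat_mono (Nat.div_le_self _ _)
        _ = (norm (zM w)).length := by rw [norm_eq_encodeNat]
        _ ≤ (zM w).length := length_norm_le _
    have hadd : (addFn (fanoutFn zCnt (fun _ => encodeNat 1) w)).length ≤ (zCnt w).length + 1 := by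
      rw [fanoutFn_apply, addFn_boolPair, bitsToNat_encodeNat]
      calc (encodeNat (bitsToNat (zCnt w) + 1)).length
          ≤ (encodeNat (bitsToNat (zCnt w))).length + 1 := by
            rw [TM2Pass.length_encodeNat_eq_size, TM2Pass.length_encodeNat_eq_size]
            exact Nat.size_le.2 (by
              have := Nat.lt_size_self (bitsToNat (zCnt w))
              calc bitsToNat (zCnt w) + 1 ≤ 2 ^ (bitsToNat (zCnt w)).size := this
                _ < 2 ^ ((bitsToNat (zCnt w)).size + 1) := Nat.pow_lt_pow_right (by norm_num) (by omega))
        _ = (norm (zCnt w)).length + 1 := by rw [norm_eq_encodeNat]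
        _ ≤ (zCnt w).length + 1 := by have := length_norm_le (zCnt w); omega
    rw [newStF]
    rcases (oneBit_valGeTwoFn.comp zM) w with ⟨c, hc⟩
    rw [iteFn_apply hc]
    cases c
    · simp only [Bool.false_eq_true, ↓reduceIte, fanoutFn_apply, Function.comp_apply, length_boolPair]
      rw [hR, hM, hP, hC] at *
      omega
    · simp only [↓reduceIte]
      obtain ⟨d, hd⟩ : ∃ d : Bool, fullF w = [d] := by
        rcases Complexity.lenLeFn_eq_or X (fanoutFn pre1F (polyFn (X + 1) ∘ zX) w) with h | h
        · exact ⟨true, h⟩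
        · exact ⟨false, h⟩
      rw [iteFn_apply hd]
      cases d
      · simp only [Bool.false_eq_true, ↓reduceIte, fanoutFn_apply, Function.comp_apply, length_boolPair]
        rw [hR, hM, hC] at *
        rw [hP] at hp1
        omega
      · simp only [↓reduceIte, fanoutFn_apply, length_boolPair, List.length_nil]
        simp only [Function.comp_apply] at hdiv hadd ⊢
        rw [hR, hM, hC] at *
        omega
  · simp only [↓reduceIte]; omega -- `rest = ε`: the state is kept

/-! ### The run, the query generator, the evaluator -/

/-- The initial record `⟨⟨x, a⟩, ⟨a, ⟨⌜⟦x⟧⌝, ⟨ε, ⌜0⌝⟩⟩⟩⟩` from the input pair `⟨x, a⟩`. [folklore] -/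
noncomputable def peelInitFn : List Bool → List Bool :=
  fanoutFn id (fanoutFn sndF (fanoutFn (norm ∘ fstF) (fun _ => boolPair [] [])))

/-- **The run**: `|⟨x, a⟩| ≥ |a|` rounds of the loop from the initial record. [folklore] -/
noncomputable def peelRunFn : List Bool → List Bool :=
  (fun z => peelRound^[X.eval (boolUnpair z).1.length] z) ∘ peelInitFn

/-- `peelInitFn ⟨x, a⟩` is the record of the initial state. [folklore] -/
theorem peelInitFn_boolPair (x a : List Bool) : peelInitFn (boolPair x a) = rec x a a (bitsToNat x, [], 0) := by
  simp [peelInitFn, rec, encSt, norm_eq_encodeNat, fanoutFn_apply]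
  rfl

/-- **Value of the run**: the record of the replay of all of `a` from `⟨⟦x⟧, ε, 0⟩`.
[cite: AroraBarak2009, §2.7] -/
theorem peelRunFn_boolPair (x a : List Bool) :
    peelRunFn (boolPair x a) = rec x a [] (replay (x.length + 1) (bitsToNat x, [], 0) a) := by
  have hn : a.length ≤ X.eval (boolUnpair (rec x a a (bitsToNat x, [], 0))).1.length := by
    simp [rec]
  rw [peelRunFn, Function.comp_apply, peelInitFn_boolPair, iterate_peelRound]
  rw [List.drop_eq_nil_of_le hn, List.take_of_length_le hn]

/-- **`peelRunFn ∈ FP`** (a clocked loop of an additively growing `FP` round). [cite: AroraBarak2009, §1.3] -/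
theorem peelRunFn_mem_FP : peelRunFn ∈ FP :=
  comp_mem_FP (iterate_mem_FP peelRound_mem_FP 9 length_peelRound_le X)
    (fanoutFn_mem_FP (PolyTimeComputable.id _) (fanoutFn_mem_FP sndF_mem_FP
      (fanoutFn_mem_FP (comp_mem_FP norm_mem_FP fstF_mem_FP) (const_mem_FP _))))

/-- **The query generator**: `⟨⌜M⌝, ⌜θ⌝⟩` with `M` the current cofactor and `θ` the value of the
threshold string `1^{D−1−|pre|} 0 preᴿ` (`BinarySearchPP.qryNum`) of the current digit prefix.
[cite: AroraBarak2009, Lemma 17.7 (proof)] -/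
noncomputable def peelQryFn : List Bool → List Bool :=
  fanoutFn (zM ∘ peelRunFn) (norm ∘ numFn X (zPre ∘ peelRunFn))

/-- **`peelQryFn ∈ FP`.** [cite: AroraBarak2009, §1.3] -/
theorem peelQryFn_mem_FP : peelQryFn ∈ FP :=
  fanoutFn_mem_FP (comp_mem_FP (nthF_mem_FP 2) peelRunFn_mem_FP)
    (comp_mem_FP norm_mem_FP (numFn_mem_FP (comp_mem_FP (nthF_mem_FP 3) peelRunFn_mem_FP)))

/-- **Value of the query generator** on `⟨x, a⟩`: with `(M, pre, cnt)` the replay of `a`,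
the query is `⟨⌜M⌝, ⌜val (qryNum (|x|+1) pre)⌝⟩`. [cite: AroraBarak2009, Lemma 17.7 (proof)] -/
theorem peelQryFn_boolPair (x a : List Bool) :
    peelQryFn (boolPair x a) =
      boolPair (encodeNat (replay (x.length + 1) (bitsToNat x, [], 0) a).1)
        (encodeNat (bitsToNat (qryNum (x.length + 1) (replay (x.length + 1) (bitsToNat x, [], 0) a).2.1))) := by
  rw [peelQryFn, fanoutFn_apply, Function.comp_apply, peelRunFn_boolPair, zM_rec, Function.comp_apply, numFn_apply,
    Function.comp_apply, peelRunFn_boolPair, zPre_rec, norm_eq_encodeNat, eval_X]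

/-- **The evaluator bit** `[x = ⌜⟦x⟧⌝ ∧ x ≠ ε ∧ (Even cnt = ¬par)]` (`par = 1`: `cnt` odd). [folklore] -/
noncomputable def peelEvalFn (par : Bool) : List Bool → List Bool :=
  andFn (eqPairFn ∘ fanoutFn fstF (norm ∘ fstF))
    (andFn (notFn (isNilFn ∘ fstF)) (eqPairFn ∘ fanoutFn (Brick.parityFn ∘ zCnt ∘ peelRunFn) (fun _ => [!par])))

/-- `peelEvalFn par ∈ FP`. [cite: AroraBarak2009, §1.3] -/
theorem peelEvalFn_mem_FP (par : Bool) : peelEvalFn par ∈ FP :=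
  andFn_mem_FP (comp_mem_FP eqPairFn_mem_FP (fanoutFn_mem_FP fstF_mem_FP (comp_mem_FP norm_mem_FP fstF_mem_FP)))
    (andFn_mem_FP (notFn_mem_FP (comp_mem_FP isNilFn_mem_FP fstF_mem_FP))
      (comp_mem_FP eqPairFn_mem_FP (fanoutFn_mem_FP
        (comp_mem_FP Brick.parityFn_mem_FP (comp_mem_FP (sndPow_mem_FP 3) peelRunFn_mem_FP)) (const_mem_FP _))))

/-- `peelEvalFn par` is one-bit. [folklore] -/
theorem oneBit_peelEvalFn (par : Bool) : OneBit (peelEvalFn par) :=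
  oneBit_andFn (QuantumComplexity.oneBit_eqPairFn.comp _)
    (oneBit_andFn (oneBit_notFn (oneBit_isNilFn.comp _)) (QuantumComplexity.oneBit_eqPairFn.comp _))

/-- **Value of the evaluator** on `⟨x, a⟩`. [folklore] -/
theorem peelEvalFn_boolPair (par : Bool) (x a : List Bool) :
    peelEvalFn par (boolPair x a) = [true] ↔
      x = encodeNat (bitsToNat x) ∧ x ≠ [] ∧
        decide (Odd (replay (x.length + 1) (bitsToNat x, [], 0) a).2.2) = par := by
  rw [peelEvalFn, Brick.andFn_eq_true_iff (QuantumComplexity.oneBit_eqPairFn.comp _)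
      (oneBit_andFn (oneBit_notFn (oneBit_isNilFn.comp _)) (QuantumComplexity.oneBit_eqPairFn.comp _)),
    Brick.andFn_eq_true_iff (oneBit_notFn (oneBit_isNilFn.comp _)) (QuantumComplexity.oneBit_eqPairFn.comp _),
    Brick.notFn_eq_true_iff (oneBit_isNilFn.comp _)]
  simp only [Function.comp_apply, fanoutFn_apply, fstF_boolPair, eqPairFn_boolPair, norm_eq_encodeNat,
    List.singleton_inj, decide_eq_true_eq, isNilFn, peelRunFn_boolPair, zCnt_rec, Brick.parityFn, bitsToNat_encodeNat]
  have : ∀ n : ℕ, (decide (Even n) = !par) ↔ (decide (Odd n) = par) := by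
    intro n; cases par <;> by_cases h : Even n <;> simp [h, Nat.not_even_iff_odd.symm]
  rw [this]

end LiouvilleOracle

end Literature.Computability.QuantumComplexity
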